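import Summits.QuantumFields.YangMills.Theorems.BalabanUVNodesN21LevelLedgerLinearGrowth

/-!
# N21 (NE7c) · the dilation road AT THE END: level constants `3(d_j+1)∕(1−ρ_j)` with a polynomial block dimension are
# in ROW T's summable regime ⇒ `T4IndicatorShell.ShellWeightBound`

R134 seat pub-ymgap-dag-n21-d (g8), node N21 = NE7c (single-run shell-weight bound, NOT PRINTED in [Bałaban 1983–89],
NOT proved), lane K3⁷ `SpineGivenEndpointR13SepCoPH` (stmt-QuantumFields-20544, `--kind proof --supports … --as helper`).
Part 17 of the comparison series; imports `…N21LevelLedgerLinearGrowth` (G2∕ROW T) only — the level constants it speaks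
about are those produced slot by slot by part 16 `…N21DilationHazard.slot_field_of_homogeneous`
(`D_j = 3(d_j + 1)∕(1 − ρ_j)`, `d_j` = block dimension of the level-`j` fibre).

WHAT THIS FILE IS.  Arithmetic + the END by name.  §1: with `0 ≤ ρ_j ≤ ½` and a POLYNOMIAL block dimension
`d_j ≤ d₀(j^p + 1)` (device (α)'s `(LM₂R_j)⁴` with a polynomial reach profile `R_j`), the dilation constants satisfy
`D_j ≤ 6(d₀ + 1)(j^p + 1)` (`dilationConst_le_pow`), hence `Σ_j D_j ρ_j < ∞` for `ρ_j ≤ c₁ϑ^j`, `ϑ < 1`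
(`summable_dilationConst_mul`, ROW T's `summable_of_pow_mul_geometric`).  §2: two `T4ShellMeasureLevels.LevelLedger`s
whose level constants ARE the dilation constants, in live windows, give `T4IndicatorShell.ShellWeightBound` and the
smallness `ω^A K + ω^B K < ε` eventually (`shellWeightBound_of_levels_dilation`, `eventually_omega_add_lt_dilation`; ROW T's
`shellWeightBound_of_levels_summable` ∕ `eventually_omega_add_lt_summable` BY NAME).  The LevelLedgers' `slot` fields are
where part 16 enters; their other fields (cover, sh ≤ A) and the `LiveWindow` are the lineage's standing dictionary
binders (NODE O's term object, N20's window∕count) — displayed, not discharged.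

HONEST FRAMING.  [folklore] bookkeeping; 0 def, 0 sorry; NE7c NOT PRINTED ∕ NOT proved; N21 NOT discharged; counts
unmoved (typed 28∕28 · discharged 5∕27); count-neutral; one finite 𝕋⁴ at fixed ε — nothing about ℝ⁴ ∕ OS ∕ mass gap ∕
Clay.
-/

open Finset Filter

namespace Summit.QuantumFields.YangMills.Theorems.N21DilationRoadEnd

open Literature.MathematicalPhysics.QuantumFieldTheory.Balaban1983to89
open T4IndicatorShell T4ShellMeasureLevels
open Summit.QuantumFields.YangMills.Theorems.N21LevelLedgerLinearGrowth
  (summable_of_pow_mul_geometric shellWeightBound_of_levels_summable eventually_omega_add_lt_summable)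

/-! ## §1 Arithmetic of the dilation constants -/

/-- `ρ ≤ ½`, `0 ≤ d` ⇒ `3(d+1)∕(1−ρ) ≤ 6(d+1)`. [folklore] -/
theorem dilationConst_le {d ρ : ℝ} (hd : 0 ≤ d) (hρ : ρ ≤ 1 / 2) :
    3 * (d + 1) / (1 - ρ) ≤ 6 * (d + 1) := by
  rw [div_le_iff₀ (by linarith)]
  nlinarith

/-- the dilation constants are nonnegative (`ρ < 1`, `d ≥ 0`). [folklore] -/
theorem dilationConst_nonneg {d ρ : ℝ} (hd : 0 ≤ d) (hρ : ρ < 1) : 0 ≤ 3 * (d + 1) / (1 - ρ) :=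
  div_nonneg (by positivity) (by linarith)

/-- **POLYNOMIAL BLOCK DIMENSION ⇒ POLYNOMIAL DILATION CONSTANTS**: `d_j ≤ d₀(j^p + 1)` (`d₀ ≥ 0`), `0 ≤ ρ_j ≤ ½` ⇒
`3(d_j + 1)∕(1 − ρ_j) ≤ 6(d₀ + 1)·(j^p + 1)` (`d₀ ≥ 0` follows from `0 ≤ d_0 ≤ d₀`). [folklore] -/
theorem dilationConst_le_pow {d ρ : ℕ → ℝ} {d₀ : ℝ} {p : ℕ} (hd0 : ∀ j, 0 ≤ d j)
    (hd : ∀ j, d j ≤ d₀ * ((j : ℝ) ^ p + 1)) (hρ : ∀ j, ρ j ≤ 1 / 2) (j : ℕ) :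
    3 * (d j + 1) / (1 - ρ j) ≤ 6 * (d₀ + 1) * ((j : ℝ) ^ p + 1) := by
  have hjp : (1 : ℝ) ≤ (j : ℝ) ^ p + 1 := by
    have : (0 : ℝ) ≤ (j : ℝ) ^ p := by positivity
    linarith
  calc 3 * (d j + 1) / (1 - ρ j) ≤ 6 * (d j + 1) := dilationConst_le (hd0 j) (hρ j)
    _ ≤ 6 * (d₀ * ((j : ℝ) ^ p + 1) + 1 * ((j : ℝ) ^ p + 1)) := by nlinarith [hd j]
    _ = 6 * (d₀ + 1) * ((j : ℝ) ^ p + 1) := by ring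

/-- **THE DILATION ROAD'S TOLERANCE IS SUMMABLE**: `Σ_j D_j ρ_j < ∞` for `D_j = 3(d_j+1)∕(1−ρ_j)` with polynomial `d_j`
and geometric `ρ_j ≤ c₁ϑ^j` (`0 ≤ ϑ < 1`), `ρ_j ≤ ½` — ROW T's `summable_of_pow_mul_geometric` BY NAME. [folklore] -/
theorem summable_dilationConst_mul {d ρ : ℕ → ℝ} {d₀ c₁ ϑ : ℝ} {p : ℕ} (hϑ0 : 0 ≤ ϑ) (hϑ1 : ϑ < 1)
    (hd0 : ∀ j, 0 ≤ d j) (hd : ∀ j, d j ≤ d₀ * ((j : ℝ) ^ p + 1)) (hρ0 : ∀ j, 0 ≤ ρ j)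
    (hρhalf : ∀ j, ρ j ≤ 1 / 2) (hρ : ∀ j, ρ j ≤ c₁ * ϑ ^ j) :
    Summable (fun j => (3 * (d j + 1) / (1 - ρ j)) * ρ j) :=
  summable_of_pow_mul_geometric hϑ0 hϑ1 (fun j => dilationConst_nonneg (hd0 j) (by linarith [hρhalf j])) hρ0
    (dilationConst_le_pow hd0 hd hρhalf) hρ

/-! ## §2 The END by name -/

section TwoRuns

variable {ι σ σ' : Type*} {l₀ : ℝ} {T : ℕ → Finset ι} {A B shA shB : ℕ → ℝ → ι → ℝ}
  {SA : ℕ → Finset σ} {SB : ℕ → Finset σ'} {pieceA : ℕ → ℝ → σ → ι → ℝ} {pieceB : ℕ → ℝ → σ' → ι → ℝ}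
  {lvlA : ℕ → σ → ℕ} {lvlB : ℕ → σ' → ℕ} {dA ρA dB ρB : ℕ → ℝ} {N₁ : ℕ} {νbar d₀ c₁ ϑ : ℝ} {p : ℕ}

/-- **NE7c FROM THE DILATION ROAD (at the END, by name).**  Two level ledgers whose level constants are the dilation
constants `3(d_j + 1)∕(1 − ρ_j)` of part 16 (per-slot `slot` fields from `…N21DilationHazard.slot_field_of_homogeneous`),
in live windows, with polynomial block dimensions and geometric widths `≤ ½`, give
`T4IndicatorShell.ShellWeightBound l₀ T A B shA shB (ω^A + ω^B)`. [folklore] -/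
theorem shellWeightBound_of_levels_dilation
    (hA : LevelLedger l₀ T A shA SA pieceA lvlA (fun j => 3 * (dA j + 1) / (1 - ρA j)) ρA)
    (hB : LevelLedger l₀ T B shB SB pieceB lvlB (fun j => 3 * (dB j + 1) / (1 - ρB j)) ρB)
    (hwA : LiveWindow SA lvlA N₁ νbar) (hwB : LiveWindow SB lvlB N₁ νbar)
    (hϑ0 : 0 ≤ ϑ) (hϑ1 : ϑ < 1)
    (hdA0 : ∀ j, 0 ≤ dA j) (hdA : ∀ j, dA j ≤ d₀ * ((j : ℝ) ^ p + 1))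
    (hdB0 : ∀ j, 0 ≤ dB j) (hdB : ∀ j, dB j ≤ d₀ * ((j : ℝ) ^ p + 1))
    (hρAhalf : ∀ j, ρA j ≤ 1 / 2) (hρA : ∀ j, ρA j ≤ c₁ * ϑ ^ j)
    (hρBhalf : ∀ j, ρB j ≤ 1 / 2) (hρB : ∀ j, ρB j ≤ c₁ * ϑ ^ j) :
    ShellWeightBound l₀ T A B shA shB (fun K => hA.toSlotLedger.omega K + hB.toSlotLedger.omega K) :=
  shellWeightBound_of_levels_summable hA hB hwA hwB
    (summable_dilationConst_mul hϑ0 hϑ1 hdA0 hdA hA.ρ_nonneg hρAhalf hρA)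
    (summable_dilationConst_mul hϑ0 hϑ1 hdB0 hdB hB.ρ_nonneg hρBhalf hρB)

/-- … and the smallness the consumers want (`T4IndicatorShell.relWeightBound_ref`'s `hlt`): `ω^A K + ω^B K < ε`
eventually. [folklore] -/
theorem eventually_omega_add_lt_dilation
    (hA : LevelLedger l₀ T A shA SA pieceA lvlA (fun j => 3 * (dA j + 1) / (1 - ρA j)) ρA)
    (hB : LevelLedger l₀ T B shB SB pieceB lvlB (fun j => 3 * (dB j + 1) / (1 - ρB j)) ρB)
    (hwA : LiveWindow SA lvlA N₁ νbar) (hwB : LiveWindow SB lvlB N₁ νbar)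
    (hϑ0 : 0 ≤ ϑ) (hϑ1 : ϑ < 1)
    (hdA0 : ∀ j, 0 ≤ dA j) (hdA : ∀ j, dA j ≤ d₀ * ((j : ℝ) ^ p + 1))
    (hdB0 : ∀ j, 0 ≤ dB j) (hdB : ∀ j, dB j ≤ d₀ * ((j : ℝ) ^ p + 1))
    (hρAhalf : ∀ j, ρA j ≤ 1 / 2) (hρA : ∀ j, ρA j ≤ c₁ * ϑ ^ j)
    (hρBhalf : ∀ j, ρB j ≤ 1 / 2) (hρB : ∀ j, ρB j ≤ c₁ * ϑ ^ j) {ε : ℝ} (hε : 0 < ε) :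
    ∀ᶠ K in atTop, hA.toSlotLedger.omega K + hB.toSlotLedger.omega K < ε :=
  eventually_omega_add_lt_summable hA hB hwA hwB
    (summable_dilationConst_mul hϑ0 hϑ1 hdA0 hdA hA.ρ_nonneg hρAhalf hρA)
    (summable_dilationConst_mul hϑ0 hϑ1 hdB0 hdB hB.ρ_nonneg hρBhalf hρB) hε

end TwoRuns

end Summit.QuantumFields.YangMills.Theorems.N21DilationRoadEnd
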